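import Summits.FinalStateConjecture.FinalStateConjecture.Theorems.StarvedNecksNecksCertifyStubChartSurgery

/-!
# Route StarvedNecks — crux `GapDecaySuffices` (stmt-FinalStateConjecture-18060), line `Sketch`: stub `stub_chartSurgeryCore`

`stub_chartSurgeryCore : ChartSurgeryCore` — the CHART SURGERY, CORE FORM, of the line skeleton
`Cruxes/GapDecaySuffices/Lines/Sketch.lean` (S5 section), stated with the skeleton's bundles `HonestCore`,
`NeckCertificate` (K1–K12) and `NeckAtlas` (A1–A13) inlined verbatim as `let`s, `ConeSeparated`
unfolded, and the goal `ChartSurgeryCore` itself a final `let` so that the statement ENDS in the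
registered text (a Theorems file cannot import the Cruxes workfile; the lead closes the skeleton stub by
`exact stub_chartSurgeryCore`, `let`/δ-unfolding being definitional — as for the landed S1
`…Bootstrap.stub_gapBootstrap` and `…LabelMatch.labelMatching_of_tubeAnchoredR_same`).

This is literally the landed rung N1b′ `…Theorems.NecksCertifyTwoCap.Bookkeeping.stub_chartSurgery`
(`StarvedNecksNecksCertifyStubChartSurgery.lean`) with its `HonestFar` bundle and antecedent DELETED: the
landed proof binds that hypothesis as `_hf` and never uses it (and destructs `HonestCore` as
`⟨hc1, -, -, -⟩`), so the line's relabelled input — whose reflected hole charts break clause `Hf`(3) for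
`d.N ≥ 2` — still feeds the chain N1b′ → N2.  The statement below is the landed one minus the two
deletions; the proof is the landed body verbatim, using the landed one-dimensional helpers
`exists_coneThreshold` / `exists_forall_le_mul_max_add` of that module (imported and opened, not copied)
and the landed `one_le_lorentz_time`, `flatTime_mem_Icc`.

PROOF (recalled from the landed file).  Pure real-number / set bookkeeping, no chart is modified: the
atlas is instantiated with the certificate's `R₁`, the walls `ρ'ᵢ := 5ρₐᵢ`, the certified radii
`Rg := Rc`, the re-gauged charts `Ψ' := Ψₐ`, and the LATER flat time `τ₁' := max τ₁ (max τc T)`.  Every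
A-clause is the corresponding K-clause restricted to the later time, except A10 — coordinate-disjointness
of the certified tubes `+2` of different holes at flat-late times — which is the cone separation
transported through `exists_coneThreshold` (`Rc` monotone and sublinear in hole time, hole time affinely
dominated by flat time on the orthochronous backgrounds, `ClockRadii.flatTime_mem_Icc`).

Mathlib + the landed modules only; no definitions, no named facts, no `sorry`.
-/

noncomputable section

open scoped Manifold ContDiff Topology ENNReal
open Filter Set MeasureTheory Topology Literature.Geometry.Lorentzian

namespace Summit.FinalStateConjecture.FinalStateConjecture.Theorems.GapDecaySuffices.ChartSurgeryCore

-- `Summit.FinalStateConjecture.FinalStateConjecture.…` is the mandated problem namespace (summit = problem name).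
set_option linter.dupNamespace false

open Summit.FinalStateConjecture.FinalStateConjecture.Theorems.NecksCertifyTwoCap.Bookkeeping
open Summit.FinalStateConjecture.FinalStateConjecture.Theorems.NecksCertifyBargmann.Seam
  (one_le_lorentz_time)
open Summit.FinalStateConjecture.FinalStateConjecture.Theorems.NecksCertifyBargmann.ClockRadii
  (flatTime_mem_Icc)

/-! ## The registered stub `stub_chartSurgeryCore` -/

set_option maxHeartbeats 400000 in
/-- **Registered stub `stub_chartSurgeryCore : ChartSurgeryCore`** of the line `Sketch` of the crux
`GapDecaySuffices` (statement = the skeleton's `ChartSurgeryCore` with `ConeSeparated` unfolded and the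
bundles `HonestCore`, `NeckCertificate`, `NeckAtlas` and the goal `ChartSurgeryCore` itself inlined verbatim as
`let`s, so that the header ends in the registered text `ChartSurgeryCore`; = the landed N1b′
`…Bookkeeping.stub_chartSurgery` minus its unused `HonestFar` binder): the analysis certificate K1–K12 of
a core-honest `C⁴` decomposition plus the cone separation of its holes give the audited atlas A1–A13.
Witnesses: `R₁`, `τ₁' := max τ₁ (max τc T)` (`T` a bound of the finitely many cone thresholds
`exists_coneThreshold` of the holes, `Finite.exists_le`), `ρ' := 5ρₐ`, `Rg := Rc`, `Ψ' := Ψₐ`.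
A4 ← K1 (`ρₐ ≥ R₁ + 1 ≥ 1` by `Hc`(1) and `d.mass_pos`), `Rg`-clause/A9 ← K2, A5 ← K3, A1 ← K4
(`ContMDiffOn.mono`, `IsOpenEmbedding.inclusion` of the open smaller tube, image monotonicity), A2 = K5,
A3 ← K6, A6 = K7, A7/A8 ← K8/K9 (`supCkENorm_mono`), A11 ← K10, A12 ← K11, A13 ← K12 (definitionally the
same flat sets), and A10 from the cone separation through `exists_coneThreshold` for the two holes
(`flatTime_mem_Icc`, `one_le_lorentz_time`, `Kerr.radius_nonneg`). [folklore] -/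
theorem stub_chartSurgeryCore :
    let HonestCore := fun (𝓢 : Spacetime.{0} 4) (O : Set 𝓢.carrier) (k : ℕ)
        (d : FinalStateDecomposition 𝓢 O k) (R₀ : ℝ) ↦
      let B := d.background; let t := fun i ↦ (B i).time; let r := fun i ↦ (B i).radius; let Ψ := d.chart;
      (∀ i, Kerr.IsSubextremal (d.mass i) (d.spin i) ∧ 100 * d.mass i ≤ R₀ ∧ 0 < ((d.motion i).1 : E4 ≃L[ℝ] E4) (E4.basisVector 0) 0) ∧
        (∀ i (ϱ τ₂ : ℝ), R₀ ≤ ϱ → d.τ₀ < τ₂ → Ψ i '' {x | d.τ₀ < t i x.1 ∧ t i x.1 < τ₂ ∧ r i x.1 < ϱ} ⊆ 𝓢.metric.causalPast 𝓢.timeOrientation (Ψ i '' (B i).truncTimeSlab ϱ τ₂)) ∧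
        (∀ i (τ' : ℝ) (ϱ : ℝ → ℝ), Continuous ϱ → d.τ₀ < τ' → let A := Ψ i '' {x | τ' ≤ t i x.1 ∧ r i x.1 ≤ ϱ (t i x.1)}; closure A ∩ O ⊆ A) ∧
        (∀ y : d.flatDomain, d.τ₀ < y.1 0 → 𝓢.timeOrientation.IsFutureDirected (mfderiv 𝓘(ℝ, E4) (𝓡 4) d.flatChart y (E4.basisVector 0)))
    let NeckCertificate := fun (𝓢 : Spacetime.{0} 4) (O : Set 𝓢.carrier)
        (d : FinalStateDecomposition 𝓢 O 4) (R₀ : ℝ) ↦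
      let B := d.background; let t := fun i ↦ (B i).time; let r := fun i ↦ (B i).radius
      let Λ := fun i ↦ ((d.motion i).1 : E4 ≃L[ℝ] E4); let Φ := d.flatChart; let Ψ := d.chart
      let ρ := d.excision
      ∃ (R₁ τ₁ : ℝ) (ρa Rc : Fin d.N → ℝ → ℝ) (Ψa : ∀ i, (B i).domain → 𝓢.carrier),
        R₀ ≤ R₁ ∧ d.τ₀ ≤ τ₁ ∧
        -- K1: analysis walls (flat-time indexed)
        (∀ i, Monotone (ρa i) ∧ Continuous (ρa i) ∧ Tendsto (fun s ↦ ρa i s / s) atTop (𝓝 0) ∧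
          Tendsto (ρa i) atTop atTop ∧ ∀ s, R₁ + 1 ≤ ρa i s ∧ (τ₁ ≤ s → ρ i s + 1 ≤ ρa i s)) ∧
        -- K2: certified radii (hole-time indexed), exhausting every radius
        (∀ i, Monotone (Rc i) ∧ Continuous (Rc i) ∧ Tendsto (fun s ↦ Rc i s / s) atTop (𝓝 0) ∧
          Tendsto (Rc i) atTop atTop ∧ ∀ s, R₁ + 4 ≤ Rc i s) ∧
        -- K3: the certified tubes swallow the analysis region with margin 3
        (∀ j (y : E4), τ₁ ≤ y 0 → r j y ≤ 9 * ρa j (y 0) → r j y + 3 ≤ Rc j (t j y)) ∧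
        -- K4: the re-gauged charts on the late tubes
        (∀ i, let U : Set (B i).domain := {x | τ₁ < t i x.1 ∧ r i x.1 < Rc i (t i x.1) + 2}
          ContMDiffOn 𝓘(ℝ, E4) (𝓡 4) ∞ (Ψa i) U ∧ IsOpenEmbedding (U.restrict (Ψa i)) ∧
            Ψa i '' U ⊆ d.charted) ∧
        -- K5: near zone untouched
        (∀ i (x : (B i).domain), r i x.1 ≤ R₁ + 1 → Ψa i x = Ψ i x) ∧
        -- K6: ONE ATLAS on the whole analysis collar `4ρa ≤ rᵢ ≤ Rc + 2` (flat-late)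
        (∀ i (y : E4) (hy : y ∈ (B i).domain), τ₁ ≤ y 0 → 4 * ρa i (y 0) ≤ r i y →
          r i y ≤ Rc i (t i y) + 2 → ∃ hy' : y ∈ d.flatDomain, Ψa i ⟨y, hy⟩ = Φ ⟨y, hy'⟩) ∧
        -- K7: C² certification out to Rc (the analytic content)
        (∀ i, Tendsto (fun τ ↦ 𝓢.truncDeviationCk (B i) (Ψa i) 2 (Rc i τ) τ) atTop (𝓝 0)) ∧
        -- K8/K9: C⁰ honesty and future-directed hole time-lines on `R₁ ≤ rᵢ ≤ Rc + 2`
        (∀ i, supCkENorm (Subtype.val '' {x : (B i).domain | τ₁ ≤ t i x.1 ∧ R₁ ≤ r i x.1 ∧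
            r i x.1 ≤ Rc i (t i x.1) + 2}) 0 (𝓢.deviationExtend (B i) (Ψa i)) ≤
          ENNReal.ofReal (1 / (10 * ‖(Λ i : E4 →L[ℝ] E4)‖ ^ 2))) ∧
        (∀ i (x : (B i).domain), τ₁ ≤ t i x.1 → R₁ ≤ r i x.1 → r i x.1 ≤ Rc i (t i x.1) + 2 →
          𝓢.timeOrientation.IsFutureDirected
            (mfderiv 𝓘(ℝ, E4) (𝓡 4) (Ψa i) x ((Λ i) (E4.basisVector 0)))) ∧
        -- K10: images of different holes' late tubes are disjoint
        (∀ i j, i ≠ j → Disjoint (Ψa i '' {x | τ₁ < t i x.1 ∧ r i x.1 < Rc i (t i x.1) + 2})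
          (Ψa j '' {x | τ₁ < t j x.1 ∧ r j x.1 < Rc j (t j x.1) + 2})) ∧
        -- K11: late tube portions (continuous profiles below Rc + 2) are relatively closed in O
        (∀ i (τ' : ℝ) (ϱ : ℝ → ℝ), Continuous ϱ → τ₁ < τ' → (∀ s, ϱ s < Rc i s + 2) →
          closure (Ψa i '' {x | τ' ≤ t i x.1 ∧ r i x.1 ≤ ϱ (t i x.1)}) ∩ O ⊆
            Ψa i '' {x | τ' ≤ t i x.1 ∧ r i x.1 ≤ ϱ (t i x.1)}) ∧
        -- K12: causal covering by the analysis atlas, for every COMPATIBLE choice of late thresholds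
        (∀ (T : ℝ) (Th : Fin d.N → ℝ), τ₁ < T → (∀ j, τ₁ < Th j) →
          (∀ j (y : E4), T < y 0 → r j y ≤ Rc j (t j y) + 2 → Th j < t j y) →
          O \ (Φ '' {y | T < y.1 0 ∧ ∀ j, 5 * ρa j (y.1 0) < r j y.1} ∪
              ⋃ j, Ψa j '' {x | Th j < t j x.1 ∧ r j x.1 < Rc j (t j x.1) + 2}) ⊆
            𝓢.metric.causalPast 𝓢.timeOrientation
              (Φ '' {y | y.1 0 = T ∧ ∀ j, 5 * ρa j (y.1 0) < r j y.1} ∪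
                ⋃ j, Ψa j '' {x | t j x.1 = Th j ∧ r j x.1 < Rc j (t j x.1) + 2}))
    let NeckAtlas := fun (𝓢 : Spacetime.{0} 4) (O : Set 𝓢.carrier) (d : FinalStateDecomposition 𝓢 O 4)
        (R₀ : ℝ) ↦
      let B := d.background; let t := fun i ↦ (B i).time; let r := fun i ↦ (B i).radius
      let Λ := fun i ↦ ((d.motion i).1 : E4 ≃L[ℝ] E4); let Φ := d.flatChart; let Ψ := d.chart
      let ρ := d.excision
      ∃ (R₁ τ₁ : ℝ) (ρ' Rg : Fin d.N → ℝ → ℝ) (Ψ' : ∀ i, (B i).domain → 𝓢.carrier),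
        R₀ ≤ R₁ ∧ d.τ₀ ≤ τ₁ ∧
        (∀ i, Continuous (ρ' i) ∧ Tendsto (fun s ↦ ρ' i s / s) atTop (𝓝 0) ∧
          ∀ s, R₁ + 1 ≤ ρ' i s ∧ (τ₁ ≤ s → ρ i s + 1 ≤ ρ' i s)) ∧
        (∀ i, Monotone (Rg i) ∧ Continuous (Rg i) ∧ Tendsto (fun s ↦ Rg i s / s) atTop (𝓝 0) ∧
          ∀ s, R₁ + 4 ≤ Rg i s) ∧
        (∀ j (y : E4), τ₁ ≤ y 0 → r j y ≤ ρ' j (y 0) → r j y + 3 ≤ Rg j (t j y)) ∧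
        (∀ i, let U : Set (B i).domain := {x | τ₁ < t i x.1 ∧ r i x.1 < Rg i (t i x.1) + 2}
          ContMDiffOn 𝓘(ℝ, E4) (𝓡 4) ∞ (Ψ' i) U ∧ IsOpenEmbedding (U.restrict (Ψ' i)) ∧
            Ψ' i '' U ⊆ d.charted) ∧
        (∀ i (x : (B i).domain), r i x.1 ≤ R₁ + 1 → Ψ' i x = Ψ i x) ∧
        (∀ i (y : E4) (hy : y ∈ (B i).domain), τ₁ ≤ y 0 → (∀ j, ρ' j (y 0) < r j y) →
          r i y ≤ Rg i (t i y) + 2 → ∃ hy' : y ∈ d.flatDomain, Ψ' i ⟨y, hy⟩ = Φ ⟨y, hy'⟩) ∧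
        (∀ i, Tendsto (fun τ ↦ 𝓢.truncDeviationCk (B i) (Ψ' i) 2 (Rg i τ) τ) atTop (𝓝 0)) ∧
        (∀ i, supCkENorm (Subtype.val '' {x : (B i).domain | τ₁ ≤ t i x.1 ∧ R₁ ≤ r i x.1 ∧
            r i x.1 ≤ Rg i (t i x.1) + 2}) 0 (𝓢.deviationExtend (B i) (Ψ' i)) ≤
          ENNReal.ofReal (1 / (10 * ‖(Λ i : E4 →L[ℝ] E4)‖ ^ 2))) ∧
        (∀ i (x : (B i).domain), τ₁ ≤ t i x.1 → R₁ ≤ r i x.1 → r i x.1 ≤ Rg i (t i x.1) + 2 →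
          𝓢.timeOrientation.IsFutureDirected
            (mfderiv 𝓘(ℝ, E4) (𝓡 4) (Ψ' i) x ((Λ i) (E4.basisVector 0)))) ∧
        -- A9: certified radii exhaust every fixed radius
        (∀ i, Tendsto (Rg i) atTop atTop) ∧
        -- A10: certified tubes (+2) of different holes are coordinate-disjoint at flat-late times
        (∀ j j' (y : E4), j ≠ j' → τ₁ ≤ y 0 → r j y ≤ Rg j (t j y) + 2 → Rg j' (t j' y) + 2 < r j' y) ∧
        -- A11: the re-gauged images of the extended late tubes are pairwise disjoint
        (∀ i j, i ≠ j → Disjoint (Ψ' i '' {x | τ₁ < t i x.1 ∧ r i x.1 < Rg i (t i x.1) + 2})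
          (Ψ' j '' {x | τ₁ < t j x.1 ∧ r j x.1 < Rg j (t j x.1) + 2})) ∧
        -- A12: late Ψ'-tube portions (any continuous profile below Rg + 2) are relatively closed in O
        (∀ i (τ' : ℝ) (ϱ : ℝ → ℝ), Continuous ϱ → τ₁ < τ' → (∀ s, ϱ s < Rg i s + 2) →
          closure (Ψ' i '' {x | τ' ≤ t i x.1 ∧ r i x.1 ≤ ϱ (t i x.1)}) ∩ O ⊆
            Ψ' i '' {x | τ' ≤ t i x.1 ∧ r i x.1 ≤ ϱ (t i x.1)}) ∧
        -- A13: the new atlas covers O causally, for every COMPATIBLE choice of late thresholds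
        (∀ (T : ℝ) (Th : Fin d.N → ℝ), τ₁ < T → (∀ j, τ₁ < Th j) →
          (∀ j (y : E4), T < y 0 → r j y ≤ Rg j (t j y) + 2 → Th j < t j y) →
          O \ (Φ '' {y | T < y.1 0 ∧ ∀ j, ρ' j (y.1 0) < r j y.1} ∪
              ⋃ j, Ψ' j '' {x | Th j < t j x.1 ∧ r j x.1 < Rg j (t j x.1) + 2}) ⊆
            𝓢.metric.causalPast 𝓢.timeOrientation
              (Φ '' {y | y.1 0 = T ∧ ∀ j, ρ' j (y.1 0) < r j y.1} ∪
                ⋃ j, Ψ' j '' {x | t j x.1 = Th j ∧ r j x.1 < Rg j (t j x.1) + 2}))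
    let ChartSurgeryCore : Prop :=
      ∀ (X : Type) [TopologicalSpace X] [ChartedSpace E3 X] [IsManifold (𝓡 3) ∞ X] [ConnectedSpace X]
        (D : InitialDataSet (𝓡 3) X), D ∈ admissibleVacuumData X →
        ∀ 𝒟 : VacuumCauchyDevelopment D, 𝒟.IsMaximal →
        ∀ (O : Set 𝒟.carrier) (d : FinalStateDecomposition 𝒟.toSpacetime O 4) (R₀ : ℝ),
          O = exteriorOf 𝒟.toCauchyDevelopment d.charted →
          HonestCore 𝒟.toSpacetime O 4 d R₀ →
          NeckCertificate 𝒟.toSpacetime O d R₀ →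
          (∃ c : ℝ, 0 < c ∧ ∃ τc : ℝ, ∀ (i j : Fin d.N) (y : E4), i ≠ j → τc ≤ y 0 →
            (d.background i).radius y ≤ c * y 0 → c * y 0 < (d.background j).radius y) →
          NeckAtlas 𝒟.toSpacetime O d R₀
    ChartSurgeryCore := by
  intro HonestCore NeckCertificate NeckAtlas ChartSurgeryCore X _ _ _ _ D _hD 𝒟 _h𝒟 O d R₀ _hO hc hK hcone
  obtain ⟨hc1, -, -, -⟩ := hc
  obtain ⟨cs, hcs, τc, hsep⟩ := hcone
  obtain ⟨R₁, τ₁, ρa, Rc, Ψa, hR₁, hτ₁, hK1, hK2, hK3, hK4, hK5, hK6, hK7, hK8, hK9, hK10, hK11,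
    hK12⟩ := hK
  dsimp only at hK1 hK2 hK3 hK4 hK5 hK6 hK7 hK8 hK9 hK10 hK11 hK12
  -- the walls are `≥ 1` (`R₁ ≥ R₀ ≥ 100·massᵢ > 0`; vacuous for `d.N = 0`)
  have hρa1 : ∀ i s, 1 ≤ ρa i s := fun i s ↦ by
    linarith [((hK1 i).2.2.2.2 s).1, (hc1 i).2.1, d.mass_pos i, hR₁]
  -- Lorentz factors `γⱼ ≥ 1`, the lower clock comparison and `rⱼ ≥ 0`, hole by hole
  have hγ1 : ∀ j, 1 ≤ (((d.motion j).1 : E4 ≃L[ℝ] E4) (E4.basisVector 0)) 0 := fun j ↦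
    one_le_lorentz_time _ (hc1 j).2.2
  have hcmp := fun j (y : E4) ↦ (flatTime_mem_Icc (Λ := (d.motion j).1) (c := (d.motion j).2)
    (M := d.mass j) (a := d.spin j) (t := (d.background j).time) (r := (d.background j).radius)
    (fun _ ↦ rfl) (fun _ ↦ rfl) rfl y).1
  have hr0 : ∀ j (y : E4), 0 ≤ (d.background j).radius y := fun j y ↦ Kerr.radius_nonneg _ _
  -- cone thresholds of the holes and a common bound
  choose T hT using fun j ↦ exists_coneThreshold cs _ ((d.motion j).2 0) |d.spin j| hcs (hγ1 j)
    (Rc j) (hK2 j).1 (hK2 j).2.2.1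
  obtain ⟨Tn, hTn⟩ := Finite.exists_le T
  -- the later flat time
  obtain ⟨τ₁', hτ₁le, hτcle, hTnle⟩ : ∃ τ₁' : ℝ, τ₁ ≤ τ₁' ∧ τc ≤ τ₁' ∧ Tn ≤ τ₁' :=
    ⟨max τ₁ (max τc Tn), le_max_left _ _, (le_max_left _ _).trans (le_max_right _ _),
      (le_max_right _ _).trans (le_max_right _ _)⟩
  -- hole clocks / radii are continuous; the smaller late tubes are open subsets of the K4 tubes
  have htc : ∀ i, Continuous (d.background i).time := fun i ↦
    (PiLp.continuous_apply 2 _ 0).comp (continuous_poincareInv (d.motion i).1 (d.motion i).2)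
  have hrc : ∀ i, Continuous (d.background i).radius := fun i ↦
    (Kerr.continuous_radius _).comp (continuous_poincareInv (d.motion i).1 (d.motion i).2)
  have hsubU : ∀ i, {x : (d.background i).domain | τ₁' < (d.background i).time x.1 ∧
      (d.background i).radius x.1 < Rc i ((d.background i).time x.1) + 2} ⊆
      {x | τ₁ < (d.background i).time x.1 ∧
        (d.background i).radius x.1 < Rc i ((d.background i).time x.1) + 2} :=
    fun i x hx ↦ ⟨lt_of_le_of_lt hτ₁le hx.1, hx.2⟩
  have hopenU : ∀ i, IsOpen {x : (d.background i).domain | τ₁' < (d.background i).time x.1 ∧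
      (d.background i).radius x.1 < Rc i ((d.background i).time x.1) + 2} := fun i ↦
    (isOpen_lt continuous_const ((htc i).comp continuous_subtype_val)).inter
      (isOpen_lt ((hrc i).comp continuous_subtype_val)
        (((hK2 i).2.1.comp ((htc i).comp continuous_subtype_val)).add continuous_const))
  refine ⟨R₁, τ₁', fun i s ↦ 5 * ρa i s, Rc, Ψa, hR₁, hτ₁.trans hτ₁le, ?_,
    fun i ↦ ⟨(hK2 i).1, (hK2 i).2.1, (hK2 i).2.2.1, (hK2 i).2.2.2.2⟩, ?_, ?_, hK5, ?_, hK7, ?_, ?_,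
    fun i ↦ (hK2 i).2.2.2.1, ?_, ?_, ?_, ?_⟩
  · -- A4: the walls `5ρₐ` (K1)
    intro i
    refine ⟨continuous_const.mul (hK1 i).2.1, ?_, fun s ↦ ⟨?_, fun hs ↦ ?_⟩⟩
    · have h := (hK1 i).2.2.1.const_mul 5
      rw [mul_zero] at h
      exact h.congr fun s ↦ (mul_div_assoc _ _ _).symm
    · linarith [((hK1 i).2.2.2.2 s).1, hρa1 i s]
    · linarith [((hK1 i).2.2.2.2 s).2 (hτ₁le.trans hs), hρa1 i s]
  · -- A5: swallowing with margin 3 (K3, `5ρₐ ≤ 9ρₐ`)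
    intro j y hy h
    exact hK3 j y (hτ₁le.trans hy) (by linarith [hρa1 j (y 0)])
  · -- A1: the re-gauged charts on the smaller late tubes (K4)
    intro i
    obtain ⟨h1, h2, h3⟩ := hK4 i
    exact ⟨h1.mono (hsubU i),
      h2.comp (IsOpenEmbedding.inclusion (hsubU i) ((hopenU i).preimage continuous_subtype_val)),
      (Set.image_mono (hsubU i)).trans h3⟩
  · -- A3: one atlas (K6: outside the `5ρₐ`-tube of hole `i` is inside its collar `4ρₐ ≤ rᵢ`)
    intro i y hy h0 hall hr
    exact hK6 i y hy (hτ₁le.trans h0) (by linarith [hall i, hρa1 i (y 0)]) hr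
  · -- A7: `C⁰` honesty on the smaller set (K8)
    intro i
    have hsub8 : {x : (d.background i).domain | τ₁' ≤ (d.background i).time x.1 ∧
        R₁ ≤ (d.background i).radius x.1 ∧
          (d.background i).radius x.1 ≤ Rc i ((d.background i).time x.1) + 2} ⊆
        {x | τ₁ ≤ (d.background i).time x.1 ∧ R₁ ≤ (d.background i).radius x.1 ∧
          (d.background i).radius x.1 ≤ Rc i ((d.background i).time x.1) + 2} :=
      fun x hx ↦ ⟨hτ₁le.trans hx.1, hx.2⟩
    exact (supCkENorm_mono (Set.image_mono hsub8) _ _).trans (hK8 i)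
  · -- A8: future-directed hole time-lines (K9)
    intro i x h1 h2 h3
    exact hK9 i x (hτ₁le.trans h1) h2 h3
  · -- A10: coordinate-disjoint certified tubes `+2`, from the cone separation
    intro j j' y hjj' hy h
    have hyT : ∀ i, T i ≤ y 0 := fun i ↦ (hTn i).trans (hTnle.trans hy)
    have hj : (d.background j).radius y ≤ cs * y 0 :=
      (hT j (y 0) ((d.background j).time y) ((d.background j).radius y) (hyT j) (hr0 j y)
        (hcmp j y)).1 h
    exact (hT j' (y 0) ((d.background j').time y) ((d.background j').radius y) (hyT j') (hr0 j' y)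
      (hcmp j' y)).2 (hsep j j' y hjj' (hτcle.trans hy) hj)
  · -- A11: image-disjoint late tubes (K10 on the smaller tubes)
    intro i j hij
    exact (hK10 i j hij).mono (Set.image_mono (hsubU i)) (Set.image_mono (hsubU j))
  · -- A12: relative closedness of late tube portions (K11)
    intro i τ' ϱ hϱ hτ' hlt
    exact hK11 i τ' ϱ hϱ (lt_of_le_of_lt hτ₁le hτ') hlt
  · -- A13: causal covering for compatible thresholds (K12; the flat sets coincide definitionally)
    intro T' Th hT' hTh hcompat
    exact hK12 T' Th (lt_of_le_of_lt hτ₁le hT') (fun j ↦ lt_of_le_of_lt hτ₁le (hTh j)) hcompat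

end Summit.FinalStateConjecture.FinalStateConjecture.Theorems.GapDecaySuffices.ChartSurgeryCore

end
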